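import Summits.Schanuel.Schanuel.Theorems.DiophantineDichotomyApproximationPropertyCurveHilbertLBOf
import Summits.Schanuel.Schanuel.Theorems.DiophantineDichotomyApproximationPropertyCurveHilbertGenericSection
import HarnessLib

/-!
# Hilbert function of a space curve on a complete intersection: the lower bound (crux `ApproximationProperty`, stub `curveHilbert_lowerBound`)

Crux `stmt-Schanuel-6117` (`Summit.Schanuel.Schanuel.Theses.DiophantineDichotomy.ApproximationProperty`),
line `orbit-interpolation-determinant` (lead `prover-line-stmt-Schanuel-6117-c3-0`), registered sub-goal
`curveHilbert_lowerBound`: for a homogeneous prime `𝔭 ⊂ ℚ[x₀, …, x₃]` of Krull dimension `2` (a space curve)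
containing a complete intersection `(Q, P)` of forms of degrees `a`, `b` (`(Q)` prime, `P ∉ (Q)`),

  `H(𝔭; ν) = dim S_ν − dim 𝔭_ν ≥ (ν − a − b) · deg 𝔭`  for `ν ≥ a + b`.

This is the monomial count of the THIRD cut of the `t = 3` descent (box principle modulo the small prime
curve). It is the composition, BY NAME, of two landed theorems of the line: the generic rational hyperplane
section of a prime curve has `deg 𝔭` pairwise non-proportional points (`curveHilbert_genericSection`,
file `…CurveHilbertGenericSection.lean`, p119238) and the conditional assembly
`curveHilbert_lowerBound_of_genericSection` (file `…CurveHilbertLBOf.lean`, p119455: monotonicity of the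
Hilbert function of the section above `a + b + 1`, zeros impose independent conditions, telescoping).
Everything is PROVED; no definitions, no named facts.

Sources: Philippon, Bull. SMF 114 (1986), Lemme 3.1; M. Chardin, Bull. SMF 117 (1989); Nesterenko–Philippon
(eds.), LNM 1752, Ch. 3 Prop. 4.4.
-/

set_option linter.dupNamespace false

noncomputable section

namespace Summit.Schanuel.Schanuel.Cruxes.ApproximationProperty.OrbitInterpolationDeterminant

open Literature.NumberTheory.Transcendental.Nesterenko MvPolynomial Module
open Literature.RingTheory.MvPolynomial

/-- **Registered sub-goal `curveHilbert_lowerBound`** (crux stmt-Schanuel-6117, line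
`orbit-interpolation-determinant`): for a prime curve `𝔭 ⊇ (Q, P)` in `ℚ[x₀, …, x₃]` (`(Q)` prime of degree
`a`, `P ∉ (Q)` of degree `b`, `dim S/𝔭 = 2`) and `ν ≥ a + b`,
`(ν − a − b) · ideg 𝔭 2 + dim 𝔭_ν ≤ dim S_ν`. Composition of `curveHilbert_lowerBound_of_genericSection`
with `curveHilbert_genericSection`. [cite: Philippon1986, Lemme 3.1] -/
theorem curveHilbert_lowerBound : ∀ (Q P : Rx 3) (a b : ℕ), Q ≠ 0 → Q.IsHomogeneous a → P.IsHomogeneous b → 1 ≤ a → 1 ≤ b → (Ideal.span {Q}).IsPrime → P ∉ Ideal.span {Q} → ∀ 𝔭 : Ideal (Rx 3), 𝔭.IsPrime → (letI := MvPolynomial.gradedAlgebra (σ := Fin (3 + 1)) (R := ℚ); 𝔭.IsHomogeneous (MvPolynomial.homogeneousSubmodule (Fin (3 + 1)) ℚ)) → Q ∈ 𝔭 → P ∈ 𝔭 → ringKrullDim (Rx 3 ⧸ 𝔭) = (2 : ℕ) → ∀ ν : ℕ, a + b ≤ ν → (ν - a - b) * Literature.NumberTheory.Transcendental.Nesterenko.ideg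 𝔭 2 + Module.finrank ℚ ↥(Literature.RingTheory.MvPolynomial.idealDegree 𝔭 ν) ≤ Module.finrank ℚ ↥(MvPolynomial.homogeneousSubmodule (Fin (3 + 1)) ℚ ν) :=
  curveHilbert_lowerBound_of_genericSection curveHilbert_genericSection

end Summit.Schanuel.Schanuel.Cruxes.ApproximationProperty.OrbitInterpolationDeterminant

end
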